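import Literature.Analysis.FluidPDE.KatoLocalBoundedContinuity
import Literature.Analysis.FluidPDE.KatoContinuation
import HarnessLib

/-!
# Local Kato solutions from bounded `L³` data: the discharge of `kato_local_bounded`
(Lemarié-Rieusset, *The Navier–Stokes Problem in the 21st Century*, CRC Press 2016, Thm. 5.1,
§9.9, proof of Thm. 9.12)

Analysis/FluidPDE proof file (no definitions, no named facts). It discharges the named fact
`Literature.Analysis.FluidPDE.kato_local_bounded` (`KatoContinuation.lean`; Lemarié-Rieusset
2016, doi:10.1201/b19556, §9.9, PDF p. 260: "existence time for `t > t₀` is bounded by below by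
`1/(C‖u(t₀,·)‖_∞²)`"; proof of Thm. 9.12, p. 260; Thm. 5.1, pp. 103–105): there is an absolute
`c₀ > 0` such that every weakly divergence-free `a ∈ L³(ℝ³)` with `‖a‖_{L^∞} ≤ A` is the datum
of a Kato solution on `[0, c₀ν/A²)` bounded by `2A` — the last open leaf under the `L^∞`
continuation of Kato solutions (`IsKatoSolutionOn.continuation_of_bounded`,
`RusinSverakSingularPoint.lean`, through `continuation_of_bounded_of_kato_local_bounded`,
`KatoContinuationProofs.lean`).

`kato_local_bounded_holds` assembles the three layers: Oseen's scheme for bounded data in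
`L^∞ ∩ L^∞_t L³` (`exists_oseen_fixedPoint_bounded`, `KatoLocalBoundedPicard.lean`) run on a
representative of `a` bounded by `A` everywhere (`exists_bounded_ae_eq`) with the lifespan
`T = c₀ν/A²`, `c₀ = (16C)⁻²` (so that the smallness `C A ν^{-1/2} 2√T ≤ 1/8` holds with
equality); the `C([0,T); L³)` continuity of the fixed point
(`continuousInLpOn_oseen_fixedPoint`, `KatoLocalBoundedContinuity.lean`); and the identification
with the tree's duality form — weak divergence-freeness of the slices
(`IsWeaklyDivFree.heatExtension_of_bound`, `isWeaklyDivFree_oseenDuhamel`), the identity from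
the datum as symmetry of the caloric pairing plus the tested Duhamel term
(`integral_inner_heatExtension_comm_of_bound`,
    `integral_inner_oseenDuhamel_eq_neg_intervalIntegral`,
`NSBoundedMildOseenDuhamel.lean`; Lemarié-Rieusset 2016, Thm. 6.1, (6.12) ⇒ (6.11)), with
`w(0) = a` and `w = u` on `(0, T)`.

## Mathlib / tree search

Tree: `kato_local_bounded` (`KatoContinuation.lean`), `IsKatoSolutionOn` (`KatoMaximalTime.lean`),
`exists_oseen_fixedPoint_bounded`, `aestronglyMeasurable_oseenDuhamel`,
`exists_norm_oseenDuhamel_le_mul` (`KatoLocalBoundedPicard.lean`),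
`continuousInLpOn_oseen_fixedPoint` (`KatoLocalBoundedContinuity.lean`),
`integral_inner_heatExtension_comm_of_bound`, `IsWeaklyDivFree.heatExtension_of_bound`,
`integral_inner_oseenDuhamel_eq_neg_intervalIntegral`, `isWeaklyDivFree_oseenDuhamel`
(`NSBoundedMildOseenDuhamel.lean`), `IsWeaklyDivFree.sub` (`KatoUniqueness.lean`),
`IsWeaklyDivFree.congr_ae` (`SolenoidalL2Duality.lean`), `integrable_inner_of_memLp_conj`
(`MildL3Restart.lean`), `isMildNSSolutionFrom_zero_iff`, `heatTest_of_pos` (`MildSolution.lean`).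
Mathlib: `ae_le_eLpNormEssSup`, `StronglyMeasurable.ite`, `eLpNormEssSup_le_of_ae_bound`.

## References

* P. G. Lemarié-Rieusset, *The Navier–Stokes Problem in the 21st Century*, CRC Press 2016,
  doi:10.1201/b19556 (held; PDF pages): Thm. 5.1 (pp. 103–105), Thm. 6.1 (p. 135), Thm. 7.5
  (pp. 155–158), §9.9 and proof of Thm. 9.12 (p. 260). [LemarieRieusset2016]
* T. Kato, *Strong `L^p`-solutions of the Navier–Stokes equation in `ℝ^m`*, Math. Z. 187 (1984),
  Thm. 1 (the class). [Kato1984]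
-/

noncomputable section

open MeasureTheory Set Function Filter TopologicalSpace InnerProductSpace Metric
open _root_.Topology
open scoped RealInnerProductSpace NNReal ENNReal

namespace Literature.Analysis.FluidPDE

/-! ### Small tools -/

section Tools

variable {E : Type*} [NormedAddCommGroup E] [InnerProductSpace ℝ E] [FiniteDimensional ℝ E]
  [MeasurableSpace E] [BorelSpace E]

/-- **A bounded representative of an essentially bounded field**: if `‖a‖_{L^∞} ≤ A` then some
measurable `ā = a` a.e. satisfies `‖ā(x)‖ ≤ A` at *every* point (truncate a strongly measurable
representative where it exceeds `A`). [folklore] -/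
theorem exists_bounded_ae_eq {a : E → E} (ha : AEStronglyMeasurable a volume) {A : ℝ} (hA : 0 ≤ A)
    (hbd : eLpNorm a ∞ volume ≤ ENNReal.ofReal A) :
    ∃ b : E → E, StronglyMeasurable b ∧ b =ᵐ[volume] a ∧ ∀ x, ‖b x‖ ≤ A := by
  set a' : E → E := ha.mk a with ha'
  have hsm : StronglyMeasurable a' := ha.stronglyMeasurable_mk
  have hae : a =ᵐ[volume] a' := ha.ae_eq_mk
  have hbound : ∀ᵐ x ∂(volume : Measure E), ‖a x‖ ≤ A := by
    have h := ae_le_eLpNormEssSup (f := a) (μ := (volume : Measure E))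
    rw [← eLpNorm_exponent_top] at h
    filter_upwards [h] with x hx
    have hx' : ‖a x‖ₑ ≤ ENNReal.ofReal A := hx.trans hbd
    rwa [← ofReal_norm, ENNReal.ofReal_le_ofReal_iff hA] at hx'
  refine ⟨fun x => if ‖a' x‖ ≤ A then a' x else 0, ?_, ?_, fun x => ?_⟩
  · exact hsm.ite (measurableSet_le hsm.norm.measurable measurable_const) stronglyMeasurable_const
  · filter_upwards [hae, hbound] with x hx hxb
    rw [← hx]
    simp [hxb]
  · by_cases h : ‖a' x‖ ≤ A
    · simp [h]
    · simp [h, hA]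

/-- `C(S; Lᵖ)` only depends on the a.e. classes of the slices. [folklore] -/
theorem ContinuousInLpOn.congr_ae_slice {X : Type*} [MeasureSpace X] {G : Type*}
    [NormedAddCommGroup G] {S : Set ℝ} {p : ℝ≥0∞} {u v : ℝ → X → G} (h : ContinuousInLpOn S p u)
    (huv : ∀ t ∈ S, u t =ᵐ[volume] v t) : ContinuousInLpOn S p v := by
  refine ⟨fun t ht => (h.1 t ht).ae_eq (huv t ht), fun t₀ ht₀ => ?_⟩
  refine (h.2 t₀ ht₀).congr' ?_
  filter_upwards [self_mem_nhdsWithin] with t ht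
  exact eLpNorm_congr_ae ((huv t ht).sub (huv t₀ ht₀))

end Tools

/-! ### The discharge -/

/-- **Discharge of `kato_local_bounded`** (Lemarié-Rieusset 2016, Thm. 5.1 in
`E = L^∞((0,T) × ℝ³)` with the `L³` norm carried along, §9.9 and proof of Thm. 9.12, PDF p. 260;
`KatoContinuation.lean`). With `C` the constant of Oseen's scheme
(`exists_oseen_fixedPoint_bounded`, `p = 3`) the lifespan constant is `c₀ = (16C)⁻²`, so that
`T = c₀ν/A²` satisfies the smallness `C A ν^{-1/2} 2√T = 1/8`. For a weakly divergence-free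
`a ∈ L³(ℝ³)` with `‖a‖_∞ ≤ A`, pass to a representative bounded by `A` everywhere
(`exists_bounded_ae_eq`), run the scheme (`KatoLocalBoundedPicard.lean`), set `w(0) = a`,
`w(t) = u(t)` on `(0, T)`; then `w` is a Kato solution on `[0, T)`: the slices are weakly
divergence free (`IsWeaklyDivFree.heatExtension_of_bound`, `isWeaklyDivFree_oseenDuhamel`), the
duality identity from `a` is the symmetry of the caloric pairing plus the tested Duhamel term
(`integral_inner_heatExtension_comm_of_bound`,
    `integral_inner_oseenDuhamel_eq_neg_intervalIntegral`,
`NSBoundedMildOseenDuhamel.lean`), `w ∈ C([0,T); L³)` (`continuousInLpOn_oseen_fixedPoint`), and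
`‖w(t)‖_∞ ≤ 2A`. [cite: LemarieRieusset2016, §9.9 and Thm. 9.12 (proof, PDF p. 260), Thm. 5.1 (pp.
    103–105)] -/
theorem kato_local_bounded_holds : kato_local_bounded := by
  obtain ⟨C, hC, hscheme⟩ :=
    exists_oseen_fixedPoint_bounded (E := EuclideanSpace ℝ (Fin 3)) (p := 3) (by norm_num)
    (by norm_num)
  refine ⟨((16 * C)⁻¹) ^ 2, by positivity, ?_⟩
  intro ν A hν hA a ha3 hdiv hbd
  set T : ℝ := (16 * C)⁻¹ ^ 2 * ν / A ^ 2 with hT_def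
  have hT : 0 < T := by positivity
  -- the smallness condition holds with equality
  have hsmall : C * A * ν ^ (-(1 / 2 : ℝ)) * (2 * Real.sqrt T) ≤ 1 / 8 := by
    have hsqrtT : Real.sqrt T = (16 * C)⁻¹ * Real.sqrt ν / A := by
      rw [hT_def, show (16 * C)⁻¹ ^ 2 * ν / A ^ 2 = ((16 * C)⁻¹ * Real.sqrt ν / A) ^ 2 by
        rw [div_pow, mul_pow, Real.sq_sqrt hν.le]]
      exact Real.sqrt_sq (by positivity)
    have hνν : ν ^ (-(1 / 2 : ℝ)) * Real.sqrt ν = 1 := by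
      rw [Real.sqrt_eq_rpow, ← Real.rpow_add hν]
      norm_num
    rw [hsqrtT]
    have : C * A * ν ^ (-(1 / 2 : ℝ)) * (2 * ((16 * C)⁻¹ * Real.sqrt ν / A)) =
        (ν ^ (-(1 / 2 : ℝ)) * Real.sqrt ν) * (2 * C * A * (16 * C)⁻¹ / A) := by ring
    rw [this, hνν, one_mul]
    field_simp
    norm_num
  -- a bounded representative of the datum
  obtain ⟨b, hbm, hba, hbA⟩ := exists_bounded_ae_eq ha3.1 hA.le hbd
  have hb3 : MemLp b 3 volume := ha3.ae_eq hba.symm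
  have hbdiv : IsWeaklyDivFree b := hdiv.congr_ae hba.symm
  -- Oseen's scheme
  obtain ⟨u, hum, hubd, hu3, husl, hfix⟩ :=
    hscheme hν hT hA hbm.aestronglyMeasurable hbA hb3 hsmall
  have hA2 : (0 : ℝ) ≤ 2 * A := by positivity
  -- the solution: `w 0 = a`, `w t = u t` for `t > 0`
  set w : ℝ → EuclideanSpace ℝ (Fin 3) → EuclideanSpace ℝ (Fin 3) :=
    fun t x => if 0 < t then u t x else a x with hw_def
  set w' : ℝ → EuclideanSpace ℝ (Fin 3) → EuclideanSpace ℝ (Fin 3) :=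
    fun t x => if 0 < t then u t x else b x with hw'_def
  have hw_pos : ∀ {t : ℝ}, 0 < t → w t = u t := fun ht => funext fun x => if_pos ht
  have hw'_pos : ∀ {t : ℝ}, 0 < t → w' t = u t := fun ht => funext fun x => if_pos ht
  have hw_zero : w 0 = a := funext fun x => if_neg (lt_irrefl 0)
  have hw'_zero : w' 0 = b := funext fun x => if_neg (lt_irrefl 0)
  have hww' : ∀ t ∈ Ico 0 T, w' t =ᵐ[volume] w t := by
    intro t ht
    rcases ht.1.eq_or_lt with h | h
    · rw [← h, hw_zero, hw'_zero]
      exact hba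
    · rw [hw_pos h, hw'_pos h]
  -- the slices at positive times: `u t = e^{νtΔ}b - B^ν_0(u,u)(t)`
  have hslice : ∀ {t : ℝ}, t ∈ Ioo 0 T →
      u t = UnboundedOperators.heatExtension b (ν * t) - oseenDuhamel ν 0 u u t := fun ht =>
    funext fun x => hfix _ ht x
  have hU_top : ∀ {t : ℝ}, 0 < t → MemLp (UnboundedOperators.heatExtension b (ν * t)) ∞ volume :=
    fun ht => UnboundedOperators.memLp_heatExtension_holds
      (memLp_top_of_bound hbm.aestronglyMeasurable A (Eventually.of_forall hbA)) le_top (mul_pos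
          hν ht)
  obtain ⟨C₁, hC₁, hBsup⟩ := exists_norm_oseenDuhamel_le_mul (E := EuclideanSpace ℝ (Fin 3))
  have hB_top : ∀ {t : ℝ}, t ∈ Ioo 0 T → MemLp (oseenDuhamel ν 0 u u t) ∞ volume := fun ht =>
    memLp_top_of_bound (aestronglyMeasurable_oseenDuhamel hν hum hum hA2 hubd hubd ht.1 ht.2.le) _
      (Eventually.of_forall fun y => hBsup hν ht.1 hA2 hA2
        (fun τ hτ z => hubd τ ⟨hτ.1, hτ.2.trans ht.2⟩ z) (fun τ hτ z => hubd τ ⟨hτ.1, hτ.2.trans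
            ht.2⟩ z) y)
  refine ⟨w, ⟨⟨fun t ht => ?_, fun t ht => ?_⟩, ?_, hw_zero, ?_⟩, fun t ht => ?_⟩
  · -- weak divergence-freeness of the slices
    rcases ht.1.eq_or_lt with h | h
    · rw [← h, hw_zero]; exact hdiv
    · have htT : t ∈ Ioo 0 T := ⟨h, ht.2⟩
      rw [hw_pos h, hslice htT]
      exact (hbdiv.heatExtension_of_bound hbm.aestronglyMeasurable hbA (mul_pos hν h)).sub le_top
        (isWeaklyDivFree_oseenDuhamel hν hum hum hA2 hubd hubd h ht.2.le) (hU_top h) (hB_top htT)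
  · -- the duality identity from `a` at time `t`
    rcases ht.1.eq_or_lt with h | h
    · rw [← h]
      exact isMildNSSolutionFrom_zero_iff.2 fun φ _ _ => by rw [hw_zero]
    · have htT : t ∈ Ioo 0 T := ⟨h, ht.2⟩
      intro φ hφ hφd
      have hφc := hφ.hasCompactSupport
      have hφcont := hφ.contDiff.continuous
      have hφ1 : MemLp φ 1 volume :=
        memLp_one_iff_integrable.2 (hφcont.integrable_of_hasCompactSupport hφc)
      simp only [Pi.zero_apply, inner_zero_left, integral_zero, intervalIntegral.integral_zero,
        add_zero]
      rw [hw_pos h, hslice htT]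
      -- split the pairing of the slice
      have hiU : Integrable (fun x => ⟪UnboundedOperators.heatExtension b (ν * t) x, φ x⟫) volume :=
        integrable_inner_of_memLp_conj (p := ∞) (q := 1) (hU_top h) hφ1
      have hiB : Integrable (fun x => ⟪oseenDuhamel ν 0 u u t x, φ x⟫) volume :=
        integrable_inner_of_memLp_conj (p := ∞) (q := 1) (hB_top htT) hφ1
      have hsplit : ∫ x, ⟪(UnboundedOperators.heatExtension b (ν * t) - oseenDuhamel ν 0 u u t) x,
          φ x⟫ =
          (∫ x, ⟪UnboundedOperators.heatExtension b (ν * t) x, φ x⟫) -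
            ∫ x, ⟪oseenDuhamel ν 0 u u t x, φ x⟫ := by
        rw [← integral_sub hiU hiB]
        refine integral_congr_ae (Eventually.of_forall fun x => ?_)
        simp only [Pi.sub_apply, inner_sub_left]
      rw [hsplit]
      -- the free term: symmetry of the caloric pairing, then `b = a` a.e.
      have hfree : ∫ x, ⟪UnboundedOperators.heatExtension b (ν * t) x, φ x⟫ =
          ∫ x, ⟪a x, heatTest ν φ t x⟫ := by
        rw [integral_inner_heatExtension_comm_of_bound hbm.aestronglyMeasurable hbA hφcont hφc
            (mul_pos hν h),
          heatTest_of_pos hν h]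
        refine integral_congr_ae ?_
        filter_upwards [hba] with x hx
        rw [hx]
      -- the Duhamel term in duality form, with `w = u` on `(0, t]`
      have hduh := integral_inner_oseenDuhamel_eq_neg_intervalIntegral hν hum hA2 hubd h ht.2.le
          hφ hφd
      rw [hfree, hduh, sub_neg_eq_add]
      congr 1
      refine intervalIntegral.integral_congr_ae ?_
      refine Eventually.of_forall fun τ hτ => ?_
      rw [uIoc_of_le h.le] at hτ
      simp only [hw_pos hτ.1]
  · -- continuity in `L³` on `[0, T)`
    have hcont := continuousInLpOn_oseen_fixedPoint (E := EuclideanSpace ℝ (Fin 3)) (p := 3)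
      (by norm_num) (by norm_num)
        hν
      hbm.aestronglyMeasurable hbA hb3 hum hA2 hubd
      (L := (2 * eLpNorm b 3 volume).toNNReal) (fun t ht => ?_) husl hfix
    · exact hcont.congr_ae_slice hww'
    · rw [ENNReal.coe_toNNReal (ENNReal.mul_ne_top ENNReal.ofNat_ne_top hb3.eLpNorm_ne_top)]
      exact hu3 t ht
  · -- measurability on the slab: `w = u` there
    refine hum.congr ?_
    filter_upwards [ae_restrict_mem (measurableSet_Ioo.prod MeasurableSet.univ)] with q hq
    show u q.1 q.2 = w q.1 q.2
    rw [hw_pos (mem_prod.1 hq).1.1]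
  · -- the `L^∞` bound
    rcases ht.1.eq_or_lt with h | h
    · rw [← h, hw_zero]
      exact hbd.trans (ENNReal.ofReal_le_ofReal (by linarith))
    · rw [hw_pos h, eLpNorm_exponent_top]
      exact eLpNormEssSup_le_of_ae_bound (Eventually.of_forall fun x => hubd t ⟨h, ht.2⟩ x)

end Literature.Analysis.FluidPDE
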